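import Literature.Dynamics.Contraction.HopfOscillationSpectralRatio
import Literature.Dynamics.Contraction.BirkhoffContractionIntegral
import Literature.Analysis.OperatorTheory.PositiveKernelTransferOperator
import HarnessLib

/-!
# Hopf's inequality for positive INTEGRAL operators: oscillation contraction and the spectral ratio bound
# `|λ| ≤ tanh(Δ∕4)·λ₀` (E. Hopf 1963 Thm 4; Anselone–Lee 1974 Thm 6.2; Eveson–Nussbaum 1995 Thm 6.3)

Topic `Literature/Dynamics/Contraction`; the measure-space twin of `HopfOscillationSpectralRatio.lean` (entrywise
positive MATRICES), discharging that file's `TODO(general form)` for Hopf's own setting: a positive kernel `K(s,t) > 0`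
acting on functions on a measure space `(X, μ)` by `(Ky)(s) = ∫ K(s,t) y(t) μ(dt)`.  THEOREMS ONLY (no definition, no
named fact).  The algebra (`hopf_core_le`, `tanh_quarter_mul_add_one`) and the cross-ratio passage by Fubini
(`integral_mul_integral_le_exp_diam`) are taken BY NAME from the sibling files.

THE RESULTS.  Let `K : X → X → ℝ` be everywhere positive with bounded `2 × 2` cross-ratios,
`K s t · K s' t' ≤ e^Δ · K s t' · K s' t` — for a positive continuous kernel on a compact space this is E–N's
formula `Δ(A) = log max K(s,t)K(u,v)∕(K(s,v)K(u,t))` for the projective diameter of the integral operator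
[EvesonNussbaum1995, Thm 6.3 (11) p. 52, Remark 6.4 p. 53]; with `M = sup K`, `m = inf K` one has `Δ ≤ 2 log(M∕m)` and
`tanh(Δ∕4) ≤ (M − m)∕(M + m)`, Hopf's constant [AnseloneLee1974, §6 and Thm 6.2; HanHan2019, (2) p. 2].
* §1 HOPF's OSCILLATION INEQUALITY, integral form (`integral_osc_le`): for `x > 0` and `lo·x ≤ y ≤ hi·x` pointwise,
  `(Ky)(s)(Kx)(s') − (Ky)(s')(Kx)(s) ≤ tanh(Δ∕4)·(hi − lo)·(Kx)(s)(Kx)(s')`, i.e. `osc(Ky∕Kx) ≤ tanh(Δ∕4)·osc(y∕x)`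
  [Hopf1963, Thm 1 and Thm 4 (oscillation ratio); EvesonNussbaum1995, Thm 3.5 p. 39 (`N(L) = tanh(Δ(L)∕4)`) with Thm 6.3;
  BapatRaghavan1997, Thm 6.3.12 (the matrix proof followed here)].
* §2 THE SPECTRAL RATIO BOUND for pointwise eigenfunctions (`abs_eigenvalue_le_tanh_mul_integral`): if `Kv = λ₀v`
  with `v > 0` everywhere and `Kw = λw` with `w∕v` bounded and `w ∉ ℝv`, then `|λ| ≤ tanh(Δ∕4)·λ₀` — Hopf's
  strengthening of Jentzsch's theorem: every eigenvalue other than the principal one has modulus at most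
  `tanh(Δ∕4)·λ₀ ≤ ((M−m)∕(M+m))·λ₀` [Hopf1963, Thm 4; AnseloneLee1974, Thm 6.2 p. 70 ("if `λ ∈ σ(K)` and `λ ≠ r(K)` then
  `|λ| ≤ ((M−m)∕(M+m)) r(K)`"); HanHan2019, Thm 1.1 (`κ(A) ≤ τ(A)`, matrices)].  Proof: the oscillation of `y∕v`,
  `O_v(y) = sup y∕v − inf y∕v`, satisfies `O_v(Ky) ≤ tanh(Δ∕4)·λ₀·O_v(y)` by §1, and `O_v(λw) = |λ|·O_v(w) > 0`.
* §3 THE `L²` COROLLARY (`abs_eigenvalue_le_tanh_mul_of_kernel`, `…_of_inner_eq_zero`): on a finite measure space, for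
  a bounded strongly measurable positive kernel with cross-ratios `≤ e^Δ` and ANY bounded operator `A` on `L²(X, μ)`
  with `Aφ =ᵐ ∫ K(·,t)φ(t)` (the tree's `exists_kernelOp` ∕ `wilsonTorusTransferMatrix` shape): if `Aφ = λ₀φ` with
  `φ ≥ 0`, `φ ≠ 0` and `Aψ = λψ` with `ψ ∉ ℝφ` (e.g. `ψ ≠ 0`, `ψ ⊥ φ`), then `|λ| ≤ tanh(Δ∕4)·λ₀`.  The `L²` classes are
  replaced by the everywhere-defined representatives `s ↦ λ⁻¹ ∫ K(s,t)ψ(t)` (`exists_eigen_representative`), whose ratio to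
  the principal one is bounded by the cross-ratio bound alone (`abs_integral_div_integral_le`), and §2 applies.

HONEST FRAMING.  §2 and §3 treat real eigenpairs (the operators this serves — symmetric transfer kernels — are
self-adjoint); §2b gives Hopf's Thm 4 for COMPLEX pointwise eigenpairs of the real kernel (`norm_eigenvalue_le_tanh_mul_integral`,
the twin of the matrix `norm_eigenvalue_le_tanh_mul`), with the contraction of the oscillation for arbitrary vectors
(`ciSup_sub_ciInf_integral_le`).
Hypotheses in §1–§2 are stated EVERYWHERE rather than μ-a.e. (a SHAPE, as in `BirkhoffContractionIntegral.lean`); §3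
does the a.e. bookkeeping.  No existence of eigenpairs is claimed (Jentzsch ∕ Perron–Frobenius is the tree's
`IsPositivityImproving.exists_spectralGap`).  Textbook material; nothing here concerns any summit.  No `def`, no
`instance`, no `sorry`; standard axioms.

## References
* [Hopf1963] E. Hopf, *An inequality for positive linear integral operators*, J. Math. Mech. 12 (1963) 683–692, Thm 1, Thm 4.
* [AnseloneLee1974] P. M. Anselone, J. W. Lee, *Spectral properties of integral operators with nonnegative kernels*,
  Linear Algebra Appl. 9 (1974) 67–87, §6 (positive continuous kernels, `m = min k`, `M = max k`), Thm 6.2 (Hopf),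
  Thm 6.3 (Jentzsch) — corpus `paper:doi-10-1016-0024-3795-74-90027-5` chunks p0008–p0012.
* [EvesonNussbaum1995] S. P. Eveson, R. D. Nussbaum, Math. Proc. Camb. Phil. Soc. 117 (1995) 31–55, Thm 3.5 p. 39, §6
  Thm 6.3 (10)–(11) pp. 52–53, Remark 6.4 p. 53; p. 32 (spectral clearance) — corpus `paper:doi-10-1017-s0305004100072911`.
* [HanHan2019] W. Han, G. Han, arXiv:1906.04875, §1 (1)–(2), Thm 1.1 p. 3 ("follows from Theorem 4 in [Hopf1963], stated
  for more general positive linear operators").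
* [BapatRaghavan1997] R. B. Bapat, T. E. S. Raghavan, *Nonnegative matrices and applications*, CUP 1997, Thm 6.3.12.
-/

noncomputable section

open MeasureTheory Real Set Filter Function

namespace Literature.Dynamics.Contraction

namespace BirkhoffHopf

variable {X : Type*} [MeasurableSpace X] {μ : Measure X}

/-! ## §0 Plumbing -/

/-- A non-zero measure lives on a nonempty type (plumbing). [folklore] -/
private theorem nonempty_of_measure_ne_zero (hμ : μ ≠ 0) : Nonempty X := by
  by_contra h
  rw [not_nonempty_iff] at h
  exact hμ (Measure.eq_zero_of_isEmpty μ)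

omit [MeasurableSpace X] in
/-- The cross-ratio bound at `s = s'`, `t = t'` forces `Δ ≥ 0` (plumbing).
[cite: EvesonNussbaum1995, Thm 6.3 (11) p. 52 (`Δ(A) = log max … ≥ 0`)] -/
theorem diam_nonneg_of_crossRatio {K : X → X → ℝ} (hK : ∀ s t, 0 < K s t) {Δ : ℝ}
    (hΔ : ∀ s s' t t', K s t * K s' t' ≤ exp Δ * (K s t' * K s' t)) (s t : X) : 0 ≤ Δ :=
  one_le_exp_iff.1 (le_of_mul_le_mul_right (by simpa using hΔ s s t t) (mul_pos (hK s t) (hK s t)))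

omit [MeasurableSpace X] in
/-- Sup ∕ inf bookkeeping: if `a ≥ 0` and `a·f(s) ≤ c + a·f(s')` for all `s, s'`, then `a·(sup f − inf f) ≤ c`
(plumbing for "`O(λw) = |λ| O(w)`"). [cite: EvesonNussbaum1995, Def 2.3 p. 33 (`ω(sy∕tx) = s ω(y∕x)∕t`)] -/
theorem mul_ciSup_sub_ciInf_le [Nonempty X] {f : X → ℝ} {a c : ℝ} (ha : 0 ≤ a)
    (h : ∀ s s', a * f s ≤ c + a * f s') : a * ((⨆ s, f s) - ⨅ s, f s) ≤ c := by
  have h1 : ∀ s', a * (⨆ s, f s) ≤ c + a * f s' := fun s' => by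
    rw [Real.mul_iSup_of_nonneg ha]
    exact ciSup_le fun s => h s s'
  have h2 : a * (⨆ s, f s) - c ≤ a * ⨅ s', f s' := by
    rw [Real.mul_iInf_of_nonneg ha]
    exact le_ciInf fun s' => by linarith [h1 s']
  linarith

/-! ## §1 Hopf's oscillation inequality, integral form -/

section Osc

variable [SFinite μ] {K : X → X → ℝ} {Δ : ℝ} {x y : X → ℝ} {lo hi : ℝ}

/-- **HOPF's OSCILLATION INEQUALITY, INTEGRAL FORM** (two-point form, denominators cleared).  `K > 0` with cross-ratios
`K s t·K s' t' ≤ e^Δ·K s t'·K s' t`; `x > 0` and `lo·x ≤ y ≤ hi·x` pointwise; the four products integrable.  Then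
`(∫K(s,·)y)(∫K(s',·)x) − (∫K(s',·)y)(∫K(s,·)x) ≤ tanh(Δ∕4)·(hi − lo)·(∫K(s,·)x)(∫K(s',·)x)`, i.e.
`osc(Ky∕Kx) ≤ tanh(Δ∕4)·osc(y∕x)`: Hopf's oscillation ratio of the integral operator is at most Birkhoff's coefficient.
Proof (Bapat–Raghavan's, transported): `a_r = ∫K(r,·)(y − lo x) ≥ 0`, `b_r = ∫K(r,·)(hi x − y) ≥ 0`,
`a_r + b_r = (hi − lo)∫K(r,·)x`, the cross-ratio `a_s b_{s'} ≤ e^Δ b_s a_{s'}` by Fubini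
(`integral_mul_integral_le_exp_diam`), then the AM–GM step `hopf_core_le`.
[cite: Hopf1963, Thm 1 and Thm 4; EvesonNussbaum1995, Thm 3.5 p. 39 with Thm 6.3 (11) p. 52; BapatRaghavan1997, Thm 6.3.12] -/
theorem integral_osc_le (hK : ∀ s t, 0 < K s t) (hΔ : ∀ s s' t t', K s t * K s' t' ≤ exp Δ * (K s t' * K s' t))
    (hx : ∀ t, 0 < x t) (hlo : ∀ t, lo * x t ≤ y t) (hhi : ∀ t, y t ≤ hi * x t) {s s' : X}
    (hsx : Integrable (fun t => K s t * x t) μ) (hsy : Integrable (fun t => K s t * y t) μ)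
    (hs'x : Integrable (fun t => K s' t * x t) μ) (hs'y : Integrable (fun t => K s' t * y t) μ) :
    (∫ t, K s t * y t ∂μ) * (∫ t, K s' t * x t ∂μ) - (∫ t, K s' t * y t ∂μ) * (∫ t, K s t * x t ∂μ) ≤
      Real.tanh (Δ / 4) * (hi - lo) * ((∫ t, K s t * x t ∂μ) * (∫ t, K s' t * x t ∂μ)) := by
  by_cases hμ : μ = 0
  · subst hμ; simp
  obtain ⟨t₀⟩ := nonempty_of_measure_ne_zero hμ
  set Xs := ∫ t, K s t * x t ∂μ with hXs
  set Xs' := ∫ t, K s' t * x t ∂μ with hXs'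
  set Ys := ∫ t, K s t * y t ∂μ with hYs
  set Ys' := ∫ t, K s' t * y t ∂μ with hYs'
  -- the four linear forms `a_r = Y_r − lo X_r`, `b_r = hi X_r − Y_r`
  have e1 : ∫ t, K s t * (y t - lo * x t) ∂μ = Ys - lo * Xs := integral_mul_sub_eq hsx hsy
  have e2 : ∫ t, K s' t * (y t - lo * x t) ∂μ = Ys' - lo * Xs' := integral_mul_sub_eq hs'x hs'y
  have e3 : ∫ t, K s t * (hi * x t - y t) ∂μ = hi * Xs - Ys := integral_mul_sub_eq' hsx hsy
  have e4 : ∫ t, K s' t * (hi * x t - y t) ∂μ = hi * Xs' - Ys' := integral_mul_sub_eq' hs'x hs'y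
  have ha : 0 ≤ Ys - lo * Xs := by
    rw [← e1]; exact integral_nonneg fun t => mul_nonneg (hK s t).le (sub_nonneg.2 (hlo t))
  have ha' : 0 ≤ Ys' - lo * Xs' := by
    rw [← e2]; exact integral_nonneg fun t => mul_nonneg (hK s' t).le (sub_nonneg.2 (hlo t))
  have hb : 0 ≤ hi * Xs - Ys := by
    rw [← e3]; exact integral_nonneg fun t => mul_nonneg (hK s t).le (sub_nonneg.2 (hhi t))
  have hb' : 0 ≤ hi * Xs' - Ys' := by
    rw [← e4]; exact integral_nonneg fun t => mul_nonneg (hK s' t).le (sub_nonneg.2 (hhi t))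
  have hX0 : 0 < Xs := integral_pos_of_pos hμ (fun t => mul_pos (hK s t) (hx t)) hsx
  have hX0' : 0 < Xs' := integral_pos_of_pos hμ (fun t => mul_pos (hK s' t) (hx t)) hs'x
  -- integrability of the pieces
  have hi1 : Integrable (fun t => K s t * (y t - lo * x t)) μ := by
    have e : (fun t => K s t * (y t - lo * x t)) = fun t => K s t * y t - lo * (K s t * x t) :=
      funext fun t => by ring
    rw [e]; exact hsy.sub (hsx.const_mul lo)
  have hi2 : Integrable (fun t => K s' t * (y t - lo * x t)) μ := by
    have e : (fun t => K s' t * (y t - lo * x t)) = fun t => K s' t * y t - lo * (K s' t * x t) :=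
      funext fun t => by ring
    rw [e]; exact hs'y.sub (hs'x.const_mul lo)
  have hi3 : Integrable (fun t => K s t * (hi * x t - y t)) μ := by
    have e : (fun t => K s t * (hi * x t - y t)) = fun t => hi * (K s t * x t) - K s t * y t :=
      funext fun t => by ring
    rw [e]; exact (hsx.const_mul hi).sub hsy
  have hi4 : Integrable (fun t => K s' t * (hi * x t - y t)) μ := by
    have e : (fun t => K s' t * (hi * x t - y t)) = fun t => hi * (K s' t * x t) - K s' t * y t :=
      funext fun t => by ring
    rw [e]; exact (hs'x.const_mul hi).sub hs'y
  -- the cross-ratio of `(a, b)` is bounded by the diameter (WEAK BOUND II, by Fubini)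
  have hcross : (Ys - lo * Xs) * (hi * Xs' - Ys') ≤ exp Δ * ((hi * Xs - Ys) * (Ys' - lo * Xs')) := by
    have h := integral_mul_integral_le_exp_diam (μ := μ) (a := fun t => K s t) (b := fun t => K s' t)
      (x := fun t => hi * x t - y t) (y := fun t => y t - lo * x t) (Δ := Δ)
      (fun t => sub_nonneg.2 (hhi t)) (fun t => sub_nonneg.2 (hlo t)) (fun t t' => hΔ s s' t t')
      hi3 hi1 hi4 hi2
    rw [e1, e2, e3, e4] at h
    exact h
  -- `q = e^{Δ∕2} ≥ 1` and the AM–GM step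
  set q : ℝ := exp (Δ / 2) with hq
  have hΔ0 : 0 ≤ Δ := diam_nonneg_of_crossRatio hK hΔ s t₀
  have hq1 : 1 ≤ q := one_le_exp (by linarith)
  have hq2 : q ^ 2 = exp Δ := by rw [hq, sq, ← exp_add]; ring_nf
  have hcore := hopf_core_le hq1 ha hb ha' hb' (by rw [hq2]; exact hcross)
  have hτ : Real.tanh (Δ / 4) * (q + 1) = q - 1 := tanh_quarter_mul_add_one Δ
  have hδ0 : 0 ≤ hi - lo := by
    have := (hlo t₀).trans (hhi t₀)
    nlinarith [hx t₀]
  rcases eq_or_lt_of_le hδ0 with hδ | hδ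
  · -- `hi = lo`: then `y = lo·x`, both sides vanish
    have hhl : hi = lo := sub_eq_zero.1 hδ.symm
    have hyx : ∀ t, y t = lo * x t := fun t => le_antisymm (by have h := hhi t; rwa [hhl] at h) (hlo t)
    have hYs0 : Ys = lo * Xs := by
      rw [hYs, hXs, ← integral_const_mul]
      exact integral_congr_ae (Eventually.of_forall fun t => by simp only [hyx t]; ring)
    have hYs0' : Ys' = lo * Xs' := by
      rw [hYs', hXs', ← integral_const_mul]
      exact integral_congr_ae (Eventually.of_forall fun t => by simp only [hyx t]; ring)
    rw [hYs0, hYs0', ← hδ]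
    nlinarith [hX0, hX0']
  · -- `hi > lo`: divide `hcore` by `(hi − lo)(q + 1) > 0`
    have hq0 : 0 < q + 1 := by linarith
    have e5 : (Ys - lo * Xs) * (hi * Xs' - Ys') - (Ys' - lo * Xs') * (hi * Xs - Ys) =
        (hi - lo) * (Ys * Xs' - Ys' * Xs) := by ring
    have e6 : (Ys - lo * Xs + (hi * Xs - Ys)) * (Ys' - lo * Xs' + (hi * Xs' - Ys')) =
        (hi - lo) ^ 2 * (Xs * Xs') := by ring
    rw [e5, e6] at hcore
    -- hcore : (hi - lo) (Ys Xs' − Ys' Xs) (q + 1) ≤ (q − 1) (hi − lo)² Xs Xs'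
    have key : (hi - lo) * ((Ys * Xs' - Ys' * Xs) * (q + 1)) ≤
        (hi - lo) * ((Real.tanh (Δ / 4) * (hi - lo) * (Xs * Xs')) * (q + 1)) := by
      have e7 : (hi - lo) * ((Real.tanh (Δ / 4) * (hi - lo) * (Xs * Xs')) * (q + 1)) =
          (q - 1) * ((hi - lo) ^ 2 * (Xs * Xs')) := by rw [← hτ]; ring
      rw [e7]
      calc (hi - lo) * ((Ys * Xs' - Ys' * Xs) * (q + 1)) = (hi - lo) * (Ys * Xs' - Ys' * Xs) * (q + 1) := by ring
        _ ≤ (q - 1) * ((hi - lo) ^ 2 * (Xs * Xs')) := hcore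
    exact le_of_mul_le_mul_right (le_of_mul_le_mul_left key hδ) hq0

end Osc

/-! ## §2 The spectral ratio bound for pointwise eigenfunctions (real eigenpairs) -/

section Spectral

variable [SFinite μ] {K : X → X → ℝ} {Δ : ℝ} {v w : X → ℝ} {lam0 lam : ℝ}

/-- **THE OSCILLATION OVER THE PRINCIPAL EIGENFUNCTION CONTRACTS** (two-point form).  `K > 0` with cross-ratios
`≤ e^Δ`; `Kv = λ₀v` pointwise with `v > 0`; `Kw = λw` pointwise; `lo·v ≤ w ≤ hi·v`.  Then for all `s, s'`:
`λ·(w s∕v s) − λ·(w s'∕v s') ≤ tanh(Δ∕4)·(hi − lo)·λ₀` — i.e. `O_v(Kw) = O_v(λw) ≤ tanh(Δ∕4)·λ₀·(hi − lo)`.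
[cite: Hopf1963, Thm 4; HanHan2019, Thm 1.1 (proof strategy via Hopf's oscillation, p. 3); BapatRaghavan1997, Thm 6.3.12] -/
theorem eigen_ratio_sub_le (hμ : μ ≠ 0) (hK : ∀ s t, 0 < K s t)
    (hΔ : ∀ s s' t t', K s t * K s' t' ≤ exp Δ * (K s t' * K s' t)) (hv : ∀ t, 0 < v t)
    (hKv : ∀ s, ∫ t, K s t * v t ∂μ = lam0 * v s) (hKw : ∀ s, ∫ t, K s t * w t ∂μ = lam * w s)
    (hiv : ∀ s, Integrable (fun t => K s t * v t) μ) (hiw : ∀ s, Integrable (fun t => K s t * w t) μ)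
    {lo hi : ℝ} (hlo : ∀ t, lo * v t ≤ w t) (hhi : ∀ t, w t ≤ hi * v t) (s s' : X) :
    lam * (w s / v s) - lam * (w s' / v s') ≤ Real.tanh (Δ / 4) * (hi - lo) * lam0 := by
  have h := integral_osc_le hK hΔ hv hlo hhi (hiv s) (hiw s) (hiv s') (hiw s')
  rw [hKv s, hKv s', hKw s, hKw s'] at h
  have hlam0 : 0 < lam0 := by
    have h1 : 0 < ∫ t, K s t * v t ∂μ := integral_pos_of_pos hμ (fun t => mul_pos (hK s t) (hv t)) (hiv s)
    rw [hKv s] at h1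
    exact pos_of_mul_pos_left h1 (hv s).le
  have hvs : v s ≠ 0 := (hv s).ne'
  have hvs' : v s' ≠ 0 := (hv s').ne'
  have hD : 0 < lam0 * (v s * v s') := mul_pos hlam0 (mul_pos (hv s) (hv s'))
  have e1 : lam * (w s / v s) - lam * (w s' / v s') =
      (lam * w s * (lam0 * v s') - lam * w s' * (lam0 * v s)) / (lam0 * (v s * v s')) := by
    field_simp
  have e2 : Real.tanh (Δ / 4) * (hi - lo) * lam0 =
      Real.tanh (Δ / 4) * (hi - lo) * (lam0 * v s * (lam0 * v s')) / (lam0 * (v s * v s')) := by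
    field_simp
  rw [e1, e2]
  exact div_le_div_of_nonneg_right h hD.le

/-- **HOPF's STRENGTHENING OF JENTZSCH's THEOREM (integral operators; real eigenpairs).**  `K > 0` on a non-zero
s-finite measure space with cross-ratios `K s t·K s' t' ≤ e^Δ·K s t'·K s' t`; `Kv = λ₀v` pointwise with `v > 0`
everywhere (the principal eigenfunction); `Kw = λw` pointwise with `w∕v` bounded above and below and `w ∉ ℝv`.  Then
`|λ| ≤ tanh(Δ∕4)·λ₀`: every other eigenvalue has modulus at most Birkhoff's coefficient times the principal one — with
`M = sup K`, `m = inf K`, `tanh(Δ∕4) ≤ (M − m)∕(M + m)` recovers Hopf's printed constant.  Proof: §1 gives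
`O_v(Kw) ≤ tanh(Δ∕4)·λ₀·O_v(w)` for the oscillation `O_v(y) = sup y∕v − inf y∕v`; `O_v(Kw) = O_v(λw) = |λ|·O_v(w)`; and
`O_v(w) > 0` since `w ∉ ℝv`.
[cite: Hopf1963, Thm 4; AnseloneLee1974, Thm 6.2 (`|λ| ≤ ((M−m)∕(M+m))·r(K)` for `λ ∈ σ(K) ∖ {r(K)}`); HanHan2019, Thm 1.1 p. 3; EvesonNussbaum1995, Thm 6.3 pp. 52–53 and p. 32] -/
theorem abs_eigenvalue_le_tanh_mul_integral (hμ : μ ≠ 0) (hK : ∀ s t, 0 < K s t)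
    (hΔ : ∀ s s' t t', K s t * K s' t' ≤ exp Δ * (K s t' * K s' t)) (hv : ∀ t, 0 < v t)
    (hKv : ∀ s, ∫ t, K s t * v t ∂μ = lam0 * v s) (hKw : ∀ s, ∫ t, K s t * w t ∂μ = lam * w s)
    (hiv : ∀ s, Integrable (fun t => K s t * v t) μ) (hiw : ∀ s, Integrable (fun t => K s t * w t) μ)
    (hbdd : BddAbove (Set.range fun t => w t / v t)) (hbdd' : BddBelow (Set.range fun t => w t / v t))
    (hw : ∀ c : ℝ, w ≠ c • v) : |lam| ≤ Real.tanh (Δ / 4) * lam0 := by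
  haveI : Nonempty X := nonempty_of_measure_ne_zero hμ
  obtain ⟨s₀⟩ := (inferInstance : Nonempty X)
  set r : X → ℝ := fun t => w t / v t with hr
  set lo : ℝ := ⨅ t, r t with hlo_def
  set hi : ℝ := ⨆ t, r t with hhi_def
  have hlo : ∀ t, lo * v t ≤ w t := fun t => (le_div_iff₀ (hv t)).1 (ciInf_le hbdd' t)
  have hhi : ∀ t, w t ≤ hi * v t := fun t => (div_le_iff₀ (hv t)).1 (le_ciSup hbdd t)
  have hlam0 : 0 < lam0 := by
    have h1 : 0 < ∫ t, K s₀ t * v t ∂μ := integral_pos_of_pos hμ (fun t => mul_pos (hK s₀ t) (hv t)) (hiv s₀)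
    rw [hKv s₀] at h1
    exact pos_of_mul_pos_left h1 (hv s₀).le
  have hτ0 : 0 ≤ Real.tanh (Δ / 4) := tanh_quarter_nonneg (diam_nonneg_of_crossRatio hK hΔ s₀ s₀)
  -- the two-point inequality of §1 for the eigenfunctions
  have h2 : ∀ s s', lam * r s ≤ Real.tanh (Δ / 4) * (hi - lo) * lam0 + lam * r s' := fun s s' => by
    have h := eigen_ratio_sub_le hμ hK hΔ hv hKv hKw hiv hiw hlo hhi s s'
    simp only [hr]
    linarith
  -- `O_v(w) > 0` since `w ∉ ℝ v`
  have hpos : lo < hi := by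
    have hle : lo ≤ hi := by
      have := (hlo s₀).trans (hhi s₀)
      nlinarith [hv s₀]
    refine lt_of_le_of_ne hle fun heq => hw lo (funext fun t => ?_)
    simp only [Pi.smul_apply, smul_eq_mul]
    have h1 := hhi t
    rw [← heq] at h1
    exact le_antisymm h1 (hlo t)
  rcases le_or_gt 0 lam with hl | hl
  · rw [abs_of_nonneg hl]
    have hm := mul_ciSup_sub_ciInf_le (f := r) hl h2
    rw [← hhi_def, ← hlo_def] at hm
    have : lam * (hi - lo) ≤ Real.tanh (Δ / 4) * lam0 * (hi - lo) := by linarith [hm]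
    exact le_of_mul_le_mul_right this (by linarith)
  · rw [abs_of_neg hl]
    have h2' : ∀ s s', -lam * r s ≤ Real.tanh (Δ / 4) * (hi - lo) * lam0 + -lam * r s' := fun s s' => by
      linarith [h2 s' s]
    have hm := mul_ciSup_sub_ciInf_le (f := r) (neg_nonneg.2 hl.le) h2'
    rw [← hhi_def, ← hlo_def] at hm
    have : -lam * (hi - lo) ≤ Real.tanh (Δ / 4) * lam0 * (hi - lo) := by linarith [hm]
    exact le_of_mul_le_mul_right this (by linarith)

end Spectral

/-! ## §2b The contraction of the oscillation for an arbitrary vector; complex eigenpairs (Hopf's Thm 4 in full) -/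

section SpectralComplex

variable [SFinite μ] {K : X → X → ℝ} {Δ : ℝ} {v : X → ℝ} {lam0 : ℝ}

/-- **THE OSCILLATION OVER THE PRINCIPAL EIGENFUNCTION CONTRACTS** (sup ∕ inf form, arbitrary real `y`).  `K > 0` with
cross-ratios `≤ e^Δ`, `Kv = λ₀v` pointwise with `v > 0`; for every real `y` with `y∕v` bounded and `K(s,·)y` integrable:
`O_v(Ky) ≤ tanh(Δ∕4)·λ₀·O_v(y)`, `O_v(y) = sup_t y(t)∕v(t) − inf_t y(t)∕v(t)` — the measure-space twin of
`ciSup_sub_ciInf_mulVec_le`. [cite: Hopf1963, Thm 1 and Thm 4; EvesonNussbaum1995, Thm 3.5 p. 39 with Thm 6.3 p. 52; BapatRaghavan1997, Thm 6.3.12] -/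
theorem ciSup_sub_ciInf_integral_le (hμ : μ ≠ 0) (hK : ∀ s t, 0 < K s t)
    (hΔ : ∀ s s' t t', K s t * K s' t' ≤ exp Δ * (K s t' * K s' t)) (hv : ∀ t, 0 < v t)
    (hKv : ∀ s, ∫ t, K s t * v t ∂μ = lam0 * v s) (hiv : ∀ s, Integrable (fun t => K s t * v t) μ)
    {y : X → ℝ} (hiy : ∀ s, Integrable (fun t => K s t * y t) μ)
    (hbdd : BddAbove (Set.range fun t => y t / v t)) (hbdd' : BddBelow (Set.range fun t => y t / v t)) :
    (⨆ s, (∫ t, K s t * y t ∂μ) / v s) - (⨅ s, (∫ t, K s t * y t ∂μ) / v s) ≤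
      Real.tanh (Δ / 4) * lam0 * ((⨆ t, y t / v t) - (⨅ t, y t / v t)) := by
  haveI : Nonempty X := nonempty_of_measure_ne_zero hμ
  obtain ⟨s₀⟩ := (inferInstance : Nonempty X)
  set r : X → ℝ := fun t => y t / v t with hr
  set lo : ℝ := ⨅ t, r t with hlo_def
  set hi : ℝ := ⨆ t, r t with hhi_def
  have hlo : ∀ t, lo * v t ≤ y t := fun t => (le_div_iff₀ (hv t)).1 (ciInf_le hbdd' t)
  have hhi : ∀ t, y t ≤ hi * v t := fun t => (div_le_iff₀ (hv t)).1 (le_ciSup hbdd t)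
  have hlam0 : 0 < lam0 := by
    have h1 : 0 < ∫ t, K s₀ t * v t ∂μ := integral_pos_of_pos hμ (fun t => mul_pos (hK s₀ t) (hv t)) (hiv s₀)
    rw [hKv s₀] at h1
    exact pos_of_mul_pos_left h1 (hv s₀).le
  -- two-point form
  have h2 : ∀ s s', 1 * ((∫ t, K s t * y t ∂μ) / v s) ≤
      Real.tanh (Δ / 4) * lam0 * (hi - lo) + 1 * ((∫ t, K s' t * y t ∂μ) / v s') := by
    intro s s'
    have h := integral_osc_le hK hΔ hv hlo hhi (hiv s) (hiy s) (hiv s') (hiy s')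
    rw [hKv s, hKv s'] at h
    have hvs : v s ≠ 0 := (hv s).ne'
    have hvs' : v s' ≠ 0 := (hv s').ne'
    have hD : 0 < lam0 * (v s * v s') := mul_pos hlam0 (mul_pos (hv s) (hv s'))
    have e1 : (∫ t, K s t * y t ∂μ) / v s - (∫ t, K s' t * y t ∂μ) / v s' =
        ((∫ t, K s t * y t ∂μ) * (lam0 * v s') - (∫ t, K s' t * y t ∂μ) * (lam0 * v s)) / (lam0 * (v s * v s')) := by
      field_simp
    have e2 : Real.tanh (Δ / 4) * lam0 * (hi - lo) =
        Real.tanh (Δ / 4) * (hi - lo) * (lam0 * v s * (lam0 * v s')) / (lam0 * (v s * v s')) := by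
      field_simp
    have h3 : (∫ t, K s t * y t ∂μ) / v s - (∫ t, K s' t * y t ∂μ) / v s' ≤ Real.tanh (Δ / 4) * lam0 * (hi - lo) := by
      rw [e1, e2]; exact div_le_div_of_nonneg_right h hD.le
    linarith
  have hm := mul_ciSup_sub_ciInf_le (f := fun s => (∫ t, K s t * y t ∂μ) / v s) zero_le_one h2
  rw [one_mul] at hm
  exact hm

omit [MeasurableSpace X] in
/-- The phase-rotated real parts `y_φ = Re(e^{iφ} w)` of a complex vector with `‖w‖ ≤ M·v` satisfy `|y_φ| ≤ M·v`
(plumbing). [cite: HanHan2019, §1 (the complex extension of the Hilbert metric, set-up)] -/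
theorem abs_re_exp_mul_le {w : X → ℂ} {M : ℝ} (hM : ∀ t, ‖w t‖ ≤ M * v t) (φ : ℝ) (t : X) :
    |(Complex.exp (φ * Complex.I) * w t).re| ≤ M * v t := by
  refine (Complex.abs_re_le_norm _).trans ?_
  rw [norm_mul, Complex.norm_exp_ofReal_mul_I, one_mul]
  exact hM t

/-- **HOPF's STRENGTHENING OF JENTZSCH's THEOREM (integral operators; COMPLEX eigenpairs — Hopf's Thm 4 in full).**
`K > 0` real on a non-zero s-finite measure space with cross-ratios `≤ e^Δ`; `Kv = λ₀v` pointwise with `v > 0`; a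
COMPLEX pointwise eigenfunction `∫ K(s,t) w(t) = μ·w(s)` with `‖w‖ ≤ M·v` and `w ∉ ℂv`.  Then `‖μ‖ ≤ tanh(Δ∕4)·λ₀`:
every eigenvalue of the positive integral operator other than the principal one, real or complex, has modulus at most
Birkhoff's coefficient times `λ₀` (the measure-space twin of `norm_eigenvalue_le_tanh_mul`).  Proof: the oscillation
over `v` of `y_φ = Re(e^{iφ}w)` contracts (`ciSup_sub_ciInf_integral_le`) while `K y_φ = ‖μ‖·y_{φ + arg μ}`; take the
supremum over the phase.
[cite: Hopf1963, Thm 4; HanHan2019, Thm 1.1 p. 3 (`κ(A) ≤ τ(A)`); AnseloneLee1974, Thm 6.2; EvesonNussbaum1995, p. 32] -/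
theorem norm_eigenvalue_le_tanh_mul_integral (hμ : μ ≠ 0) (hK : ∀ s t, 0 < K s t)
    (hΔ : ∀ s s' t t', K s t * K s' t' ≤ exp Δ * (K s t' * K s' t)) (hv : ∀ t, 0 < v t)
    (hKv : ∀ s, ∫ t, K s t * v t ∂μ = lam0 * v s) (hiv : ∀ s, Integrable (fun t => K s t * v t) μ)
    {w : X → ℂ} {μc : ℂ} (hKw : ∀ s, ∫ t, (K s t : ℂ) * w t ∂μ = μc * w s)
    (hiw : ∀ s, Integrable (fun t => (K s t : ℂ) * w t) μ) {M : ℝ} (hM : ∀ t, ‖w t‖ ≤ M * v t)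
    (hw : ∀ c : ℂ, w ≠ fun t => c * (v t : ℂ)) : ‖μc‖ ≤ Real.tanh (Δ / 4) * lam0 := by
  haveI : Nonempty X := nonempty_of_measure_ne_zero hμ
  obtain ⟨s₀⟩ := (inferInstance : Nonempty X)
  -- the phase-rotated real parts and their oscillation over `v`
  set y : ℝ → X → ℝ := fun φ t => (Complex.exp (φ * Complex.I) * w t).re with hy
  set O : (X → ℝ) → ℝ := fun z => (⨆ t, z t / v t) - (⨅ t, z t / v t) with hO
  set θ : ℝ := Complex.arg μc with hθ
  set τ : ℝ := Real.tanh (Δ / 4) with hτ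
  have hτ0 : 0 ≤ τ := tanh_quarter_nonneg (diam_nonneg_of_crossRatio hK hΔ s₀ s₀)
  have hlam0 : 0 < lam0 := by
    have h1 : 0 < ∫ t, K s₀ t * v t ∂μ := integral_pos_of_pos hμ (fun t => mul_pos (hK s₀ t) (hv t)) (hiv s₀)
    rw [hKv s₀] at h1
    exact pos_of_mul_pos_left h1 (hv s₀).le
  -- (0) bounds: `−M ≤ y_φ∕v ≤ M`
  have hyb : ∀ φ t, -M ≤ y φ t / v t ∧ y φ t / v t ≤ M := fun φ t => by
    have h := abs_re_exp_mul_le (v := v) hM φ t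
    rw [abs_le] at h
    constructor
    · rw [le_div_iff₀ (hv t)]; linarith [h.1]
    · rw [div_le_iff₀ (hv t)]; exact h.2
  have hbdd : ∀ φ, BddAbove (Set.range fun t => y φ t / v t) := fun φ =>
    ⟨M, by rintro _ ⟨t, rfl⟩; exact (hyb φ t).2⟩
  have hbdd' : ∀ φ, BddBelow (Set.range fun t => y φ t / v t) := fun φ =>
    ⟨-M, by rintro _ ⟨t, rfl⟩; exact (hyb φ t).1⟩
  have hObdd : ∀ φ, O (y φ) ≤ 2 * M := fun φ => by
    have h1 : (⨆ t, y φ t / v t) ≤ M := ciSup_le fun t => (hyb φ t).2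
    have h2 : -M ≤ ⨅ t, y φ t / v t := le_ciInf fun t => (hyb φ t).1
    simp only [hO]; linarith
  have hO0 : ∀ φ, 0 ≤ O (y φ) := fun φ =>
    sub_nonneg.2 ((ciInf_le (hbdd' φ) s₀).trans (le_ciSup (hbdd φ) s₀))
  -- (1) integrability and the transported eigen-relation `K y_φ = ‖μ‖ • y_{φ+θ}`
  have hiy : ∀ φ s, Integrable (fun t => K s t * y φ t) μ := fun φ s => by
    have h := ((hiw s).const_mul (Complex.exp (φ * Complex.I))).re
    refine h.congr (Eventually.of_forall fun t => ?_)
    simp only [hy, RCLike.re_to_complex]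
    rw [← mul_assoc, mul_comm (Complex.exp _) (K s t : ℂ), mul_assoc, Complex.re_ofReal_mul]
  have hrot : ∀ φ s, ∫ t, K s t * y φ t ∂μ = ‖μc‖ * y (φ + θ) s := by
    intro φ s
    have e1 : ∫ t, K s t * y φ t ∂μ = (Complex.exp (φ * Complex.I) * ∫ t, (K s t : ℂ) * w t ∂μ).re := by
      rw [← integral_const_mul, ← RCLike.re_to_complex, ← integral_re ((hiw s).const_mul _)]
      refine integral_congr_ae (Eventually.of_forall fun t => ?_)
      simp only [hy, RCLike.re_to_complex]
      rw [← mul_assoc, mul_comm (Complex.exp _) (K s t : ℂ), mul_assoc, Complex.re_ofReal_mul]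
    have e2 : Complex.exp (φ * Complex.I) * μc = (‖μc‖ : ℂ) * Complex.exp (((φ + θ : ℝ) : ℂ) * Complex.I) := by
      conv_lhs => rw [← Complex.norm_mul_exp_arg_mul_I μc]
      rw [← hθ, Complex.ofReal_add, add_mul, Complex.exp_add]
      ring
    rw [e1, hKw s, ← mul_assoc, e2, mul_assoc, Complex.re_ofReal_mul]
  -- (2) contraction, phase by phase: `‖μ‖·O(y_{φ+θ}) ≤ τ·λ₀·O(y_φ)`
  have hstep : ∀ φ, ‖μc‖ * O (y (φ + θ)) ≤ τ * lam0 * O (y φ) := by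
    intro φ
    have h := ciSup_sub_ciInf_integral_le hμ hK hΔ hv hKv hiv (hiy φ) (hbdd φ) (hbdd' φ)
    simp_rw [hrot φ] at h
    have e : (⨆ s, ‖μc‖ * y (φ + θ) s / v s) - (⨅ s, ‖μc‖ * y (φ + θ) s / v s) = ‖μc‖ * O (y (φ + θ)) := by
      have e' : (fun s => ‖μc‖ * y (φ + θ) s / v s) = fun s => ‖μc‖ * (y (φ + θ) s / v s) :=
        funext fun s => by ring
      rw [e', ← Real.mul_iSup_of_nonneg (norm_nonneg μc), ← Real.mul_iInf_of_nonneg (norm_nonneg μc), hO, mul_sub]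
    rw [e] at h
    simpa only [hO, hτ] using h
  -- (3) the supremum over the phase
  set S : ℝ := ⨆ φ : ℝ, O (y φ) with hS
  have hSbdd : BddAbove (Set.range fun φ : ℝ => O (y φ)) := ⟨2 * M, by rintro _ ⟨φ, rfl⟩; exact hObdd φ⟩
  have hleS : ∀ φ, O (y φ) ≤ S := fun φ => le_ciSup hSbdd φ
  have hS0 : 0 ≤ S := (hO0 0).trans (hleS 0)
  have hmain : ‖μc‖ * S ≤ τ * lam0 * S := by
    rw [hS, Real.mul_iSup_of_nonneg (norm_nonneg μc)]
    refine ciSup_le fun ψ => ?_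
    have h := hstep (ψ - θ)
    rw [sub_add_cancel] at h
    exact h.trans (mul_le_mul_of_nonneg_left (hleS (ψ - θ)) (mul_nonneg hτ0 hlam0.le))
  -- (4) `S > 0`: otherwise every `y_φ` is a multiple of `v`, and then so is `w`
  have hSpos : 0 < S := by
    by_contra hle
    push Not at hle
    have hOz : ∀ φ, O (y φ) = 0 := fun φ => le_antisymm ((hleS φ).trans hle) (hO0 φ)
    have hprop : ∀ φ t, y φ t = (⨅ t, y φ t / v t) * v t := by
      intro φ t
      have h1 : (⨆ t, y φ t / v t) ≤ ⨅ t, y φ t / v t := sub_nonpos.1 (le_of_eq (hOz φ))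
      have hlo := (le_div_iff₀ (hv t)).1 (ciInf_le (hbdd' φ) t)
      have hhi := (div_le_iff₀ (hv t)).1 (le_ciSup (hbdd φ) t)
      exact le_antisymm (hhi.trans (mul_le_mul_of_nonneg_right h1 (hv t).le)) hlo
    obtain ⟨c₀, hre⟩ : ∃ c₀ : ℝ, ∀ t, (w t).re = c₀ * v t :=
      ⟨⨅ t, y 0 t / v t, fun t => by
        have := hprop 0 t
        simpa [hy] using this⟩
    obtain ⟨c₁, h1⟩ : ∃ c₁ : ℝ, ∀ t, Real.cos 1 * (w t).re - Real.sin 1 * (w t).im = c₁ * v t :=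
      ⟨⨅ t, y 1 t / v t, fun t => by
        have := hprop 1 t
        simpa [hy, Complex.mul_re, Complex.exp_ofReal_mul_I_re, Complex.exp_ofReal_mul_I_im] using this⟩
    have hsin : 0 < Real.sin 1 := Real.sin_pos_of_pos_of_lt_pi one_pos (by linarith [Real.pi_gt_three])
    set c' : ℝ := (Real.cos 1 * c₀ - c₁) / Real.sin 1 with hc'
    have him : ∀ t, (w t).im = c' * v t := fun t => by
      rw [hc', div_mul_eq_mul_div, eq_div_iff hsin.ne']
      have := h1 t
      rw [hre t] at this
      linarith
    apply hw (c₀ + c' * Complex.I)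
    funext t
    apply Complex.ext
    · simp [Complex.mul_re, hre t]
    · simp [Complex.mul_im, him t]
  exact le_of_mul_le_mul_right hmain hSpos

end SpectralComplex

/-! ## §3 The `L²` corollary: kernel operators on `L²` of a finite measure space -/

section L2

open Literature.Analysis.OperatorTheory
open scoped RealInnerProductSpace

variable [IsFiniteMeasure μ] {K : X → X → ℝ} {C Δ : ℝ} {A : Lp ℝ 2 μ →L[ℝ] Lp ℝ 2 μ}

/-- **Everywhere-defined representative of an `L²` eigenfunction of a kernel operator.**  If `Aψ = λψ` in `L²` with
`λ ≠ 0` and `Aψ =ᵐ ∫K(·,t)ψ(t)`, then `w(s) := λ⁻¹∫K(s,t)ψ(t)μ(dt)` is defined everywhere, agrees with `ψ` a.e., and is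
a POINTWISE eigenfunction: `∫K(s,t)w(t) = λ·w(s)` for every `s`.
[cite: AnseloneLee1974, §3 (c) and Thm 6.3 (proof: `Kx = λx` recovers `x` from the kernel)] -/
theorem exists_eigen_representative (hKm : StronglyMeasurable (uncurry K)) (hC : ∀ x y, ‖K x y‖ ≤ C)
    (hA : ∀ φ : Lp ℝ 2 μ, (A φ : X → ℝ) =ᵐ[μ] fun x => ∫ y, K x y * φ y ∂μ)
    {ψ : Lp ℝ 2 μ} {lam : ℝ} (hAψ : A ψ = lam • ψ) (hlam : lam ≠ 0) :
    ∃ w : X → ℝ, (w = fun s => (∫ t, K s t * ψ t ∂μ) / lam) ∧ w =ᵐ[μ] (ψ : X → ℝ) ∧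
      (∀ s, ∫ t, K s t * w t ∂μ = lam * w s) ∧ ∀ s, Integrable (fun t => K s t * w t) μ := by
  set w : X → ℝ := fun s => (∫ t, K s t * ψ t ∂μ) / lam with hw
  have h1 : (fun s => lam * ψ s) =ᵐ[μ] fun s => ∫ t, K s t * ψ t ∂μ := by
    have h := hA ψ
    rw [hAψ] at h
    filter_upwards [h, Lp.coeFn_smul lam ψ] with s hs hsm
    rw [← hs, hsm, Pi.smul_apply, smul_eq_mul]
  have hae : w =ᵐ[μ] (ψ : X → ℝ) := by
    filter_upwards [h1] with s hs
    simp only [hw, ← hs]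
    field_simp
  have hcongr : ∀ s, (fun t => K s t * w t) =ᵐ[μ] fun t => K s t * ψ t := fun s => by
    filter_upwards [hae] with t ht
    rw [ht]
  refine ⟨w, rfl, hae, fun s => ?_, fun s => (integrable_kernel_mul_coeFn hKm hC ψ s).congr (hcongr s).symm⟩
  rw [integral_congr_ae (hcongr s)]
  simp only [hw]
  field_simp

omit [IsFiniteMeasure μ] in
/-- **The cross-ratio bound alone bounds the ratio of two images.**  `K > 0` with cross-ratios `≤ e^Δ`; `g ≥ 0` a.e. with
`∫K(s₀,·)g > 0`; `K(s,·)f`, `K(s,·)g` integrable for all `s`.  Then for every `s`: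
`|∫K(s,·)f| ∕ ∫K(s,·)g ≤ e^Δ·(∫|K(s₀,·)f|) ∕ (e^{−Δ}·∫K(s₀,·)g)` — the rows `K(s,·)` and `K(s₀,·)` are comparable up
to the factor `e^{±Δ}·K(s,s₀)∕K(s₀,s₀)`, which cancels in the ratio.  (So the image of any vector is "`Kg`-bounded":
the comparability Hopf's theorem needs comes for free for integral operators.)
[cite: EvesonNussbaum1995, Lemma 3.1 (4) p. 37 and Thm 6.3 (proof, p. 53); Hopf1963, Thm 1] -/
theorem abs_integral_div_integral_le (hK : ∀ s t, 0 < K s t)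
    (hΔ : ∀ s s' t t', K s t * K s' t' ≤ exp Δ * (K s t' * K s' t)) {f g : X → ℝ} (hg : 0 ≤ᵐ[μ] g)
    (hif : ∀ s, Integrable (fun t => K s t * f t) μ) (hig : ∀ s, Integrable (fun t => K s t * g t) μ)
    (s₀ : X) (hIg : 0 < ∫ t, K s₀ t * g t ∂μ) (s : X) :
    |∫ t, K s t * f t ∂μ| / (∫ t, K s t * g t ∂μ) ≤
      (exp Δ * ∫ t, |K s₀ t * f t| ∂μ) / (exp (-Δ) * ∫ t, K s₀ t * g t ∂μ) := by
  set c : ℝ := K s s₀ / K s₀ s₀ with hc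
  have hc0 : 0 < c := div_pos (hK s s₀) (hK s₀ s₀)
  have hK00 := hK s₀ s₀
  -- row comparability: `e^{−Δ} c K(s₀,t) ≤ K(s,t) ≤ e^Δ c K(s₀,t)`
  have hup : ∀ t, K s t ≤ exp Δ * c * K s₀ t := fun t => by
    have h := hΔ s s₀ t s₀
    rw [hc]
    rw [show exp Δ * (K s s₀ / K s₀ s₀) * K s₀ t = exp Δ * (K s s₀ * K s₀ t) / K s₀ s₀ by ring,
      le_div_iff₀ hK00]
    exact h
  have hlow : ∀ t, exp (-Δ) * c * K s₀ t ≤ K s t := fun t => by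
    have h := hΔ s₀ s t s₀
    have h' : K s₀ t * K s s₀ / K s₀ s₀ ≤ exp Δ * K s t := by
      rw [div_le_iff₀ hK00]
      calc K s₀ t * K s s₀ ≤ exp Δ * (K s₀ s₀ * K s t) := h
        _ = exp Δ * K s t * K s₀ s₀ := by ring
    have e : exp (-Δ) * c * K s₀ t = exp (-Δ) * (K s₀ t * K s s₀ / K s₀ s₀) := by rw [hc]; ring
    rw [e]
    calc exp (-Δ) * (K s₀ t * K s s₀ / K s₀ s₀) ≤ exp (-Δ) * (exp Δ * K s t) :=
          mul_le_mul_of_nonneg_left h' (exp_pos _).le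
      _ = K s t := by rw [← mul_assoc, ← exp_add]; simp
  -- numerator
  have hnum : |∫ t, K s t * f t ∂μ| ≤ exp Δ * c * ∫ t, |K s₀ t * f t| ∂μ := by
    refine (abs_integral_le_integral_abs).trans ?_
    rw [← integral_const_mul]
    refine integral_mono (hif s).abs (((hif s₀).abs).const_mul _) fun t => ?_
    simp only [abs_mul, abs_of_pos (hK s t), abs_of_pos (hK s₀ t)]
    calc K s t * |f t| ≤ (exp Δ * c * K s₀ t) * |f t| := mul_le_mul_of_nonneg_right (hup t) (abs_nonneg _)
      _ = exp Δ * c * (K s₀ t * |f t|) := by ring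
  -- denominator
  have hden : exp (-Δ) * c * ∫ t, K s₀ t * g t ∂μ ≤ ∫ t, K s t * g t ∂μ := by
    rw [← integral_const_mul]
    refine integral_mono_ae ((hig s₀).const_mul _) (hig s) ?_
    filter_upwards [hg] with t ht
    calc exp (-Δ) * c * (K s₀ t * g t) = (exp (-Δ) * c * K s₀ t) * g t := by ring
      _ ≤ K s t * g t := mul_le_mul_of_nonneg_right (hlow t) ht
  have hden0 : 0 < exp (-Δ) * c * ∫ t, K s₀ t * g t ∂μ := by positivity
  have hIs : 0 < ∫ t, K s t * g t ∂μ := lt_of_lt_of_le hden0 hden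
  calc |∫ t, K s t * f t ∂μ| / (∫ t, K s t * g t ∂μ)
      ≤ (exp Δ * c * ∫ t, |K s₀ t * f t| ∂μ) / (∫ t, K s t * g t ∂μ) := div_le_div_of_nonneg_right hnum hIs.le
    _ ≤ (exp Δ * c * ∫ t, |K s₀ t * f t| ∂μ) / (exp (-Δ) * c * ∫ t, K s₀ t * g t ∂μ) :=
        div_le_div_of_nonneg_left (by positivity) hden0 hden
    _ = (c * (exp Δ * ∫ t, |K s₀ t * f t| ∂μ)) / (c * (exp (-Δ) * ∫ t, K s₀ t * g t ∂μ)) := by ring_nf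
    _ = (exp Δ * ∫ t, |K s₀ t * f t| ∂μ) / (exp (-Δ) * ∫ t, K s₀ t * g t ∂μ) := mul_div_mul_left _ _ hc0.ne'

/-- **HOPF's SPECTRAL RATIO BOUND FOR KERNEL OPERATORS ON `L²`** (finite measure space).  `K` strongly measurable,
bounded, everywhere positive, cross-ratios `K s t·K s' t' ≤ e^Δ·K s t'·K s' t`; `A` any bounded operator on
`L²(X, μ)` with `Aφ =ᵐ ∫K(·,t)φ(t)`.  If `Aφ = λ₀φ` with `φ ≥ 0`, `φ ≠ 0` (the Jentzsch ∕ Perron–Frobenius eigenvector)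
and `Aψ = λψ` with `ψ ∉ ℝφ`, then `|λ| ≤ tanh(Δ∕4)·λ₀` (so `λ₀` is simple and the rest of the point spectrum lies in
the disc of radius `tanh(Δ∕4)·λ₀ ≤ ((M−m)∕(M+m))·λ₀`).  Proof: `λ₀ > 0`; for `λ = 0` there is nothing to show; else
pass to the everywhere-defined representatives (`exists_eigen_representative`), whose ratio is bounded
(`abs_integral_div_integral_le`), and apply `abs_eigenvalue_le_tanh_mul_integral`.
[cite: Hopf1963, Thm 4; AnseloneLee1974, Thm 6.2; EvesonNussbaum1995, Thm 6.3 pp. 52–53, Remark 6.4; HanHan2019, Thm 1.1] -/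
theorem abs_eigenvalue_le_tanh_mul_of_kernel (hKm : StronglyMeasurable (uncurry K))
    (hC : ∀ x y, ‖K x y‖ ≤ C) (hK : ∀ x y, 0 < K x y)
    (hΔ : ∀ s s' t t', K s t * K s' t' ≤ exp Δ * (K s t' * K s' t))
    (hA : ∀ φ : Lp ℝ 2 μ, (A φ : X → ℝ) =ᵐ[μ] fun x => ∫ y, K x y * φ y ∂μ)
    {φ ψ : Lp ℝ 2 μ} {lam0 lam : ℝ} (hφ : IsPositiveFun φ) (hAφ : A φ = lam0 • φ)
    (hAψ : A ψ = lam • ψ) (hψ : ∀ c : ℝ, ψ ≠ c • φ) : |lam| ≤ Real.tanh (Δ / 4) * lam0 := by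
  have hμ : μ ≠ 0 := measure_ne_zero_of_ne_zero hφ.2
  haveI : (ae μ).NeBot := ae_neBot.2 hμ
  obtain ⟨s₀⟩ := nonempty_of_measure_ne_zero hμ
  have hΔ0 : 0 ≤ Δ := diam_nonneg_of_crossRatio hK hΔ s₀ s₀
  have hτ0 : 0 ≤ Real.tanh (Δ / 4) := tanh_quarter_nonneg hΔ0
  -- `∫K(s,·)φ > 0` everywhere, hence `λ₀ > 0`
  have hφ0 : 0 ≤ᵐ[μ] (φ : X → ℝ) := (Lp.coeFn_nonneg φ).2 hφ.1
  have hsupp : 0 < μ (support (φ : X → ℝ)) := by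
    rw [pos_iff_ne_zero]
    intro h0
    refine hφ.2 (Lp.eq_zero_iff_ae_eq_zero.2 ?_)
    have : ∀ᵐ x ∂μ, x ∉ support (φ : X → ℝ) := measure_eq_zero_iff_ae_notMem.1 h0
    filter_upwards [this] with x hx
    simpa [mem_support] using hx
  have hg : ∀ s, 0 < ∫ t, K s t * φ t ∂μ := fun s => by
    have hnn : 0 ≤ᵐ[μ] fun t => K s t * φ t := by
      filter_upwards [hφ0] with t ht using mul_nonneg (hK s t).le ht
    rw [integral_pos_iff_support_of_nonneg_ae hnn (integrable_kernel_mul_coeFn hKm hC φ s)]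
    have hs : support (fun t => K s t * φ t) = support (φ : X → ℝ) := by
      ext t
      simp only [mem_support, ne_eq, mul_eq_zero, (hK s t).ne', false_or]
    rwa [hs]
  have h1 : (fun s => lam0 * φ s) =ᵐ[μ] fun s => ∫ t, K s t * φ t ∂μ := by
    have h := hA φ
    rw [hAφ] at h
    filter_upwards [h, Lp.coeFn_smul lam0 φ] with s hs hsm
    rw [← hs, hsm, Pi.smul_apply, smul_eq_mul]
  have hlam0 : 0 < lam0 := by
    obtain ⟨s, hs, hs'⟩ := (h1.and hφ0).exists
    by_contra hle
    push Not at hle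
    have h2 : lam0 * φ s ≤ 0 := mul_nonpos_of_nonpos_of_nonneg hle hs'
    linarith [hg s]
  -- `λ = 0` is trivial
  rcases eq_or_ne lam 0 with rfl | hlam
  · rw [abs_zero]; positivity
  -- everywhere-defined representatives
  obtain ⟨v, hvdef, hvae, hKv, hiv⟩ := exists_eigen_representative hKm hC hA hAφ hlam0.ne'
  obtain ⟨w, hwdef, hwae, hKw, hiw⟩ := exists_eigen_representative hKm hC hA hAψ hlam
  have hvpos : ∀ s, 0 < v s := fun s => by rw [hvdef]; exact div_pos (hg s) hlam0
  -- `w∕v` is bounded (by the cross-ratio bound)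
  have hiφ : ∀ s, Integrable (fun t => K s t * φ t) μ := fun s => integrable_kernel_mul_coeFn hKm hC φ s
  have hiψ : ∀ s, Integrable (fun t => K s t * ψ t) μ := fun s => integrable_kernel_mul_coeFn hKm hC ψ s
  set B₀ : ℝ := (exp Δ * ∫ t, |K s₀ t * ψ t| ∂μ) / (exp (-Δ) * ∫ t, K s₀ t * φ t ∂μ) with hB₀
  have hB : ∀ s, |w s / v s| ≤ lam0 / |lam| * B₀ := fun s => by
    have h := abs_integral_div_integral_le hK hΔ hφ0 hiψ hiφ s₀ (hg s₀) s
    have e : w s / v s = lam0 / lam * ((∫ t, K s t * ψ t ∂μ) / ∫ t, K s t * φ t ∂μ) := by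
      rw [hwdef, hvdef]
      field_simp [(hg s).ne', hlam0.ne', hlam]
    rw [e, abs_mul, abs_div, abs_of_pos hlam0, abs_div, abs_of_pos (hg s)]
    exact mul_le_mul_of_nonneg_left h (div_nonneg hlam0.le (abs_nonneg _))
  have hbdd : BddAbove (Set.range fun t => w t / v t) :=
    ⟨lam0 / |lam| * B₀, by rintro _ ⟨t, rfl⟩; exact le_of_abs_le (hB t)⟩
  have hbdd' : BddBelow (Set.range fun t => w t / v t) :=
    ⟨-(lam0 / |lam| * B₀), by rintro _ ⟨t, rfl⟩; exact neg_le_of_abs_le (hB t)⟩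
  -- `w ∉ ℝ v`
  have hwv : ∀ c : ℝ, w ≠ c • v := by
    intro c hc
    apply hψ c
    apply Lp.ext
    filter_upwards [hwae, hvae, Lp.coeFn_smul c φ] with s hws hvs hsm
    rw [hsm, Pi.smul_apply, smul_eq_mul, ← hws, ← hvs, hc, Pi.smul_apply, smul_eq_mul]
  exact abs_eigenvalue_le_tanh_mul_integral hμ hK hΔ hvpos hKv hKw hiv hiw hbdd hbdd' hwv

/-- **… for an eigenvector ORTHOGONAL to the principal one**: `Aφ = λ₀φ` (`φ ≥ 0`, `φ ≠ 0`), `Aψ = λψ`, `ψ ≠ 0`,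
`⟪φ, ψ⟫ = 0` ⇒ `|λ| ≤ tanh(Δ∕4)·λ₀` — the form consumed with a Hilbert basis of eigenvectors of a self-adjoint kernel
operator (every basis vector other than the principal one).
[cite: Hopf1963, Thm 4; AnseloneLee1974, Thm 6.2; EvesonNussbaum1995, p. 32 (spectral clearance)] -/
theorem abs_eigenvalue_le_tanh_mul_of_kernel_of_inner_eq_zero (hKm : StronglyMeasurable (uncurry K))
    (hC : ∀ x y, ‖K x y‖ ≤ C) (hK : ∀ x y, 0 < K x y)
    (hΔ : ∀ s s' t t', K s t * K s' t' ≤ exp Δ * (K s t' * K s' t))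
    (hA : ∀ φ : Lp ℝ 2 μ, (A φ : X → ℝ) =ᵐ[μ] fun x => ∫ y, K x y * φ y ∂μ)
    {φ ψ : Lp ℝ 2 μ} {lam0 lam : ℝ} (hφ : IsPositiveFun φ) (hAφ : A φ = lam0 • φ)
    (hAψ : A ψ = lam • ψ) (hψ0 : ψ ≠ 0) (horth : ⟪φ, ψ⟫ = 0) : |lam| ≤ Real.tanh (Δ / 4) * lam0 := by
  refine abs_eigenvalue_le_tanh_mul_of_kernel hKm hC hK hΔ hA hφ hAφ hAψ fun c hc => ?_
  rw [hc, inner_smul_right, real_inner_self_eq_norm_sq] at horth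
  rcases mul_eq_zero.1 horth with h | h
  · exact hψ0 (by rw [hc, h, zero_smul])
  · exact hφ.2 (norm_eq_zero.1 (pow_eq_zero_iff two_ne_zero |>.1 h))

end L2

end BirkhoffHopf

end Literature.Dynamics.Contraction

end
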